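import Literature.Analysis.FluidPDE.Tao2016AveragedNS.ShiftSetCascadeFlows
import Literature.Analysis.FluidPDE.TaoCascadeNoLow
import HarnessLib

/-!
# Tao 2016, §4 on a shift set `𝕊`: cubic sums, the bond flux and the block energy bookkeeping

T. Tao, *Finite time blowup for an averaged three-dimensional Navier–Stokes equation*, J. Amer.
Math. Soc. **29** (2016) 601–674 = arXiv:1402.0290v3 [`Tao2016AveragedNS`], §4: the cancellation
condition (4.3), the local energy inequality (4.9) of Lemma 4.1, and the bookkeeping in the proof of
Lemma 4.1 (v) (p. 22 of the arXiv text: "By (4.3), all the terms here can be grouped into terms that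
sum to zero, except for those terms with `n = n₀ - 1` …"). The tree proves this bookkeeping on Tao's
ONE-WAY shift set `S` (`TaoCascadeNoLow`: `fullSum`, `topSum`, `botSum`, `sum_quadTerm_mul`,
`fullSum_eq_zero`, `sum_range_sum_quadTerm_mul`). This module (definition request `defn-botSumOn` of
cell harvest/h2-tao-ladder, route `TaoLadderRungTwoFlat`, crux `GappedFrontRobustV2Flat`) re-states
it with the shift set as a PARAMETER `𝕊 : Finset (ℤ × ℤ × ℤ)`, so that it applies to the two-way set
`S♭ = shiftSetFlat` of `ShiftSetCascadeFlows`: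

* `IsSlotClosed 𝕊` (stable under permutations of the three slots — the hypothesis under which (4.3)
  on `𝕊` kills the cubic sum) and `IsNearestNeighbourSet 𝕊` (`𝕊 ⊆ {0,1}³`: every triad based at
  shell `n` lives on the shells `n, n+1`); both hold for `S` and `S♭` (`decide`);
* `fullSumOn 𝕋` — the cubic sum `F_𝕋(n) = ∑_{i} ∑_{μ ∈ 𝕋} α_{i,μ} (1+ε₀)^{5n/2} X_{i₁,n+μ₁}
  X_{i₂,n+μ₂} X_{i₃,n+μ₃}` carried by the triad classes `𝕋` at base shell `n`
  (`fullSumOn shiftSet = fullSum`, `rfl`); `topShifts 𝕊` / `botShifts 𝕊` (output slot on the base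
  shell / on the shell above) and `topSumOn 𝕊 = fullSumOn (topShifts 𝕊)`,
  `botSumOn 𝕊 = fullSumOn (botShifts 𝕊)` — the BOND FLUX through the bond `n | n+1`
  (`botSumOn shiftSet = botSum`, `topSumOn shiftSet = topSum`); `coeffAbsOn 𝕋 α = ∑ |α_{i,μ}|`;
* `sum_quadTermOn_mul` — `∑ᵢ quadTermOn 𝕊 · X_{i,n} = topSumOn 𝕊 (n) + botSumOn 𝕊 (n-1)`
  (nearest-neighbour output slots), from the shape-free `sum_quadTermOn_mul_eq_sum`;
* `fullSumOn_eq_zero` — (4.3) on a slot-closed `𝕊` ⇒ `F_𝕊(n) = 0` (six relabellings), hence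
  `botSumOn = -topSumOn` and the TELESCOPING `sum_range_sum_quadTermOn_mul(_eq_botSumOn)`:
  `∑_{K ≤ k < K+L} ∑ᵢ quadTermOn·X = botSumOn(K-1) - botSumOn(K+L-1)`;
* on `S♭`: `backscatterShifts = {(1,1,0),(1,0,1),(0,1,1)}`, `shiftSetFlat = shiftSet ∪ backscatterShifts`,
  the CLASS-WISE conservation `fullSumOn_backscatterShifts_eq_zero` (the backscatter class is itself
  slot-closed), and the flux decomposition `botSumOn_shiftSetFlat_eq_botSum_sub`: through the bond
  `n | n+1` the flux on `S♭` is the one-way flux `botSum(n)` (quadratic in the shell `n` BELOW the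
  bond) minus the backscatter cubic term of class `(1,1,0)` (quadratic in the shell `n+1` ABOVE it);
* TWO-SIDED size lemmas for `fullSumOn 𝕋` on a nearest-neighbour `𝕋` (hence for `botSumOn`,
  `topSumOn`): from amplitude bounds (`abs_fullSumOn_le_of_abs_le`, slot-wise weights
  `abs_fullSumOn_le_of_slot_bounds`), from energies (`abs_fullSumOn_le_energy`: two factors through
  `½X² ≤ E` on the shells `n, n+1`, the third by an amplitude bound), and the `(E_n + E_{n+1})^{3/2}`
  form `abs_fullSumOn_le_energy_three_halves`; continuity of `quadTermOn`, `fullSumOn`, `botSumOn`;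
* `PseudoFlowOnShift.energy_cap` ((4.9) integrated) and the BLOCK ENERGY INEQUALITY
  `PseudoFlowOnShift.block_energy_le`: along a pseudo-flow on `𝕊` with a cancelling table the energy
  of the block `K, …, K+L-1` grows at most by `∫ (botSumOn(K-1) - botSumOn(K+L-1))`.

Unlike on `S`, on `S♭` the flux through a bond is NOT controlled by the energy below the bond alone
(the backscatter term is quadratic in the upper shell): the size lemmas here use both shells. MODEL
lattice objects only — nothing in this module is a statement about the Navier–Stokes equations; every
`def … : Prop` is a PREDICATE with parameters, none is asserted.
-/

noncomputable section

open Set MeasureTheory intervalIntegral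

namespace Literature.Analysis.FluidPDE

namespace TaoCascade

variable {m : ℕ}

/-! ### Shift-set geometry -/

/-- A shift set `𝕊` is **slot-closed** when it is stable under the transpositions of slots
`(μ₁,μ₂,μ₃) ↦ (μ₂,μ₁,μ₃)` and `(μ₁,μ₂,μ₃) ↦ (μ₁,μ₃,μ₂)` (hence under all six slot permutations): the
hypothesis under which the cancellation condition (4.3) on `𝕊` groups the cubic sum over `𝕊` into
vanishing six-term packets. [cite: Tao2016AveragedNS, §4 (4.3) and proof of Lemma 4.1 (v); cell vocabulary, shift-set parametrised] -/
def IsSlotClosed (𝕊 : Finset (ℤ × ℤ × ℤ)) : Prop :=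
  ∀ μ ∈ 𝕊, (μ.2.1, μ.1, μ.2.2) ∈ 𝕊 ∧ (μ.1, μ.2.2, μ.2.1) ∈ 𝕊

/-- A shift set `𝕊` is **nearest-neighbour** when `𝕊 ⊆ {0,1}³`: every triad based at shell `n` has
its three modes on the shells `n` and `n+1` only (Tao's `S` and the two-way `S♭` are of this kind).
[cite: Tao2016AveragedNS, §4 after (4.1) (the shift set S); cell vocabulary, shift-set parametrised] -/
def IsNearestNeighbourSet (𝕊 : Finset (ℤ × ℤ × ℤ)) : Prop :=
  ∀ μ ∈ 𝕊, (μ.1 = 0 ∨ μ.1 = 1) ∧ (μ.2.1 = 0 ∨ μ.2.1 = 1) ∧ (μ.2.2 = 0 ∨ μ.2.2 = 1)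

/-- Tao's one-way shift set `S` is slot-closed. [cite: Tao2016AveragedNS, §4 after (4.1); cell vocabulary, shift-set parametrised] -/
theorem isSlotClosed_shiftSet : IsSlotClosed shiftSet := by
  unfold IsSlotClosed
  decide

/-- The two-way shift set `S♭` is slot-closed. [cite: Tao2016AveragedNS, §4 after (4.1) and p. 9 footnote 7; cell vocabulary, shift-set parametrised] -/
theorem isSlotClosed_shiftSetFlat : IsSlotClosed shiftSetFlat := by
  unfold IsSlotClosed
  decide

/-- Tao's one-way shift set `S` is nearest-neighbour. [cite: Tao2016AveragedNS, §4 after (4.1); cell vocabulary, shift-set parametrised] -/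
theorem isNearestNeighbourSet_shiftSet : IsNearestNeighbourSet shiftSet := by
  unfold IsNearestNeighbourSet
  decide

/-- The two-way shift set `S♭` is nearest-neighbour. [cite: Tao2016AveragedNS, §4 after (4.1) and p. 9 footnote 7; cell vocabulary, shift-set parametrised] -/
theorem isNearestNeighbourSet_shiftSetFlat : IsNearestNeighbourSet shiftSetFlat := by
  unfold IsNearestNeighbourSet
  decide

/-- A sub-family of a nearest-neighbour shift set is nearest-neighbour. [cite: Tao2016AveragedNS, §4 after (4.1) (the shift set); cell vocabulary, shift-set parametrised] -/
theorem IsNearestNeighbourSet.mono {𝕊 𝕋 : Finset (ℤ × ℤ × ℤ)} (h𝕊 : IsNearestNeighbourSet 𝕊)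
    (h : 𝕋 ⊆ 𝕊) : IsNearestNeighbourSet 𝕋 :=
  fun μ hμ => h𝕊 μ (h hμ)

/-- On a nearest-neighbour shift set every output slot is `0` or `1`. [cite: Tao2016AveragedNS, §4 after (4.1) (the shift set); cell vocabulary, shift-set parametrised] -/
theorem IsNearestNeighbourSet.out_eq_zero_or_one {𝕊 : Finset (ℤ × ℤ × ℤ)}
    (h𝕊 : IsNearestNeighbourSet 𝕊) : ∀ μ ∈ 𝕊, μ.2.2 = 0 ∨ μ.2.2 = 1 :=
  fun μ hμ => (h𝕊 μ hμ).2.2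

/-- Cancellation (4.3) on `𝕊` restricts to every sub-family of shifts. [cite: Tao2016AveragedNS, §4 (4.3); cell vocabulary, shift-set parametrised] -/
theorem IsCancellingCoeffOn.mono {𝕊 𝕋 : Finset (ℤ × ℤ × ℤ)}
    {α : Fin m → Fin m → Fin m → ℤ × ℤ × ℤ → ℝ} (hα : IsCancellingCoeffOn 𝕊 α) (h : 𝕋 ⊆ 𝕊) :
    IsCancellingCoeffOn 𝕋 α :=
  fun i₁ i₂ i₃ μ₁ μ₂ μ₃ hμ => hα i₁ i₂ i₃ μ₁ μ₂ μ₃ (h hμ)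

/-- Symmetry (4.2) on `𝕊` restricts to every sub-family of shifts. [cite: Tao2016AveragedNS, §4 (4.2); cell vocabulary, shift-set parametrised] -/
theorem IsSymmetricCoeffOn.mono {𝕊 𝕋 : Finset (ℤ × ℤ × ℤ)}
    {α : Fin m → Fin m → Fin m → ℤ × ℤ × ℤ → ℝ} (hα : IsSymmetricCoeffOn 𝕊 α) (h : 𝕋 ⊆ 𝕊) :
    IsSymmetricCoeffOn 𝕋 α :=
  fun i₁ i₂ i₃ μ₁ μ₂ μ₃ hμ => hα i₁ i₂ i₃ μ₁ μ₂ μ₃ (h hμ)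

/-! ### Relabelling sums over a slot-closed shift set -/

/-- Relabelling a sum over a slot-closed shift set by the transposition of the first two slots.
[cite: Tao2016AveragedNS, §4 (4.3) and proof of Lemma 4.1 (v) (grouping of terms); cell vocabulary, shift-set parametrised] -/
theorem IsSlotClosed.sum_swap₁₂ {M : Type*} [AddCommMonoid M] {𝕊 : Finset (ℤ × ℤ × ℤ)}
    (h𝕊 : IsSlotClosed 𝕊) (f : ℤ × ℤ × ℤ → M) :
    ∑ μ ∈ 𝕊, f (μ.2.1, μ.1, μ.2.2) = ∑ μ ∈ 𝕊, f μ :=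
  Finset.sum_nbij' (fun μ => (μ.2.1, μ.1, μ.2.2)) (fun μ => (μ.2.1, μ.1, μ.2.2))
    (fun μ hμ => (h𝕊 μ hμ).1) (fun μ hμ => (h𝕊 μ hμ).1) (fun _ _ => rfl) (fun _ _ => rfl)
    (fun _ _ => rfl)

/-- Relabelling a sum over a slot-closed shift set by the transposition of the last two slots.
[cite: Tao2016AveragedNS, §4 (4.3) and proof of Lemma 4.1 (v) (grouping of terms); cell vocabulary, shift-set parametrised] -/
theorem IsSlotClosed.sum_swap₂₃ {M : Type*} [AddCommMonoid M] {𝕊 : Finset (ℤ × ℤ × ℤ)}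
    (h𝕊 : IsSlotClosed 𝕊) (f : ℤ × ℤ × ℤ → M) :
    ∑ μ ∈ 𝕊, f (μ.1, μ.2.2, μ.2.1) = ∑ μ ∈ 𝕊, f μ :=
  Finset.sum_nbij' (fun μ => (μ.1, μ.2.2, μ.2.1)) (fun μ => (μ.1, μ.2.2, μ.2.1))
    (fun μ hμ => (h𝕊 μ hμ).2) (fun μ hμ => (h𝕊 μ hμ).2) (fun _ _ => rfl) (fun _ _ => rfl)
    (fun _ _ => rfl)

/-- Relabelling the finite index set `(i₁,i₂,i₃,μ)` over a slot-closed `𝕊` by the transposition of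
the first two slots (the tree's `Tao2016.sum_slots_swap₁₂` for `S`).
[cite: Tao2016AveragedNS, §4 (4.3) and proof of Lemma 4.1 (v) (grouping of terms); cell vocabulary, shift-set parametrised] -/
theorem IsSlotClosed.sum_slots_swap₁₂ {M : Type*} [AddCommMonoid M] {𝕊 : Finset (ℤ × ℤ × ℤ)}
    (h𝕊 : IsSlotClosed 𝕊) (g : Fin m → Fin m → Fin m → ℤ × ℤ × ℤ → M) :
    ∑ i₁, ∑ i₂, ∑ i₃, ∑ μ ∈ 𝕊, g i₁ i₂ i₃ μ =
      ∑ i₁, ∑ i₂, ∑ i₃, ∑ μ ∈ 𝕊, g i₂ i₁ i₃ (μ.2.1, μ.1, μ.2.2) := by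
  conv_rhs => rw [Finset.sum_comm]
  refine Finset.sum_congr rfl fun i₁ _ => Finset.sum_congr rfl fun i₂ _ =>
    Finset.sum_congr rfl fun i₃ _ => ?_
  exact (h𝕊.sum_swap₁₂ (g i₁ i₂ i₃)).symm

/-- Relabelling the finite index set `(i₁,i₂,i₃,μ)` over a slot-closed `𝕊` by the transposition of
the last two slots (the tree's `Tao2016.sum_slots_swap₂₃` for `S`).
[cite: Tao2016AveragedNS, §4 (4.3) and proof of Lemma 4.1 (v) (grouping of terms); cell vocabulary, shift-set parametrised] -/
theorem IsSlotClosed.sum_slots_swap₂₃ {M : Type*} [AddCommMonoid M] {𝕊 : Finset (ℤ × ℤ × ℤ)}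
    (h𝕊 : IsSlotClosed 𝕊) (g : Fin m → Fin m → Fin m → ℤ × ℤ × ℤ → M) :
    ∑ i₁, ∑ i₂, ∑ i₃, ∑ μ ∈ 𝕊, g i₁ i₂ i₃ μ =
      ∑ i₁, ∑ i₂, ∑ i₃, ∑ μ ∈ 𝕊, g i₁ i₃ i₂ (μ.1, μ.2.2, μ.2.1) := by
  refine Finset.sum_congr rfl fun i₁ _ => ?_
  conv_rhs => rw [Finset.sum_comm]
  refine Finset.sum_congr rfl fun i₂ _ => Finset.sum_congr rfl fun i₃ _ => ?_
  exact (h𝕊.sum_swap₂₃ (g i₁ i₂ i₃)).symm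

/-! ### The cubic sums over a family of shifts -/

/-- The **cubic sum of the table `α` over the shifts `𝕋` at base shell `n`**:
`F_𝕋(n) = ∑_{i₁,i₂,i₃} ∑_{μ ∈ 𝕋} α_{i,μ} (1+ε₀)^{5n/2} X_{i₁,n+μ₁} X_{i₂,n+μ₂} X_{i₃,n+μ₃}` — for the
whole shift set the scale-`n` slice of `⟨C_𝕊(u,u),u⟩` (`fullSumOn shiftSet = fullSum`, `rfl`), for a
sub-family `𝕋 ⊆ 𝕊` the part of it carried by the triad classes in `𝕋`.
[cite: Tao2016AveragedNS, §4 (4.3) and proof of Lemma 4.1 (v); cell vocabulary, shift-set parametrised] -/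
def fullSumOn (𝕋 : Finset (ℤ × ℤ × ℤ)) (ε₀ : ℝ) (α : Fin m → Fin m → Fin m → ℤ × ℤ × ℤ → ℝ)
    (X : Fin m → ℤ → ℝ → ℝ) (n : ℤ) (t : ℝ) : ℝ :=
  ∑ i₁, ∑ i₂, ∑ i₃, ∑ μ ∈ 𝕋, α i₁ i₂ i₃ μ * (1 + ε₀) ^ ((5 : ℝ) * n / 2) *
    (X i₁ (n + μ.1) t * X i₂ (n + μ.2.1) t * X i₃ (n + μ.2.2) t)

/-- The shifts of `𝕊` whose OUTPUT slot sits on the base shell (`μ₃ = 0`).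
[cite: Tao2016AveragedNS, §4 proof of Lemma 4.1 (v); cell vocabulary, shift-set parametrised] -/
def topShifts (𝕊 : Finset (ℤ × ℤ × ℤ)) : Finset (ℤ × ℤ × ℤ) :=
  𝕊.filter fun μ => μ.2.2 = 0

/-- The shifts of `𝕊` whose OUTPUT slot sits on the shell above the base (`μ₃ = 1`): the triad
classes through which the base-`n` interaction feeds the shell `n+1`.
[cite: Tao2016AveragedNS, §4 proof of Lemma 4.1 (v); cell vocabulary, shift-set parametrised] -/
def botShifts (𝕊 : Finset (ℤ × ℤ × ℤ)) : Finset (ℤ × ℤ × ℤ) :=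
  𝕊.filter fun μ => μ.2.2 = 1

/-- `A_𝕊(n)`: the part of the cubic sum over `𝕊` at base shell `n` with output on the shell `n`
(`topSumOn shiftSet = topSum`). [cite: Tao2016AveragedNS, §4 proof of Lemma 4.1 (v); cell vocabulary, shift-set parametrised] -/
def topSumOn (𝕊 : Finset (ℤ × ℤ × ℤ)) (ε₀ : ℝ) (α : Fin m → Fin m → Fin m → ℤ × ℤ × ℤ → ℝ)
    (X : Fin m → ℤ → ℝ → ℝ) (n : ℤ) (t : ℝ) : ℝ :=
  fullSumOn (topShifts 𝕊) ε₀ α X n t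

/-- `B_𝕊(n)`, the **bond flux**: the part of the cubic sum over `𝕊` at base shell `n` with output on
the shell `n+1` — the rate at which the base-`n` triads move energy across the bond `n | n+1`
(`botSumOn shiftSet = botSum`; under (4.3) the energy of any block of shells changes only through the
bond fluxes at its two ends, `sum_range_sum_quadTermOn_mul_eq_botSumOn`).
[cite: Tao2016AveragedNS, §4 proof of Lemma 4.1 (v); cell vocabulary, shift-set parametrised] -/
def botSumOn (𝕊 : Finset (ℤ × ℤ × ℤ)) (ε₀ : ℝ) (α : Fin m → Fin m → Fin m → ℤ × ℤ × ℤ → ℝ)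
    (X : Fin m → ℤ → ℝ → ℝ) (n : ℤ) (t : ℝ) : ℝ :=
  fullSumOn (botShifts 𝕊) ε₀ α X n t

/-- The total size of the table on the shifts `𝕋`, `∑_{i₁,i₂,i₃} ∑_{μ ∈ 𝕋} |α_{i,μ}|` (the tree's
`coeffAbs` is the case `𝕋 = topShifts shiftSet`). [cite: Tao2016AveragedNS, §4 (4.1) (the structure constants); cell vocabulary, shift-set parametrised] -/
def coeffAbsOn (𝕋 : Finset (ℤ × ℤ × ℤ)) (α : Fin m → Fin m → Fin m → ℤ × ℤ × ℤ → ℝ) : ℝ :=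
  ∑ i₁, ∑ i₂, ∑ i₃, ∑ μ ∈ 𝕋, |α i₁ i₂ i₃ μ|

/-- `∑|α| ≥ 0`. [cite: Tao2016AveragedNS, §4 (4.1) (the structure constants); cell vocabulary, shift-set parametrised] -/
theorem coeffAbsOn_nonneg (𝕋 : Finset (ℤ × ℤ × ℤ)) (α : Fin m → Fin m → Fin m → ℤ × ℤ × ℤ → ℝ) :
    0 ≤ coeffAbsOn 𝕋 α :=
  Finset.sum_nonneg fun _ _ => Finset.sum_nonneg fun _ _ => Finset.sum_nonneg fun _ _ =>
    Finset.sum_nonneg fun _ _ => abs_nonneg _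

/-- The cubic sum over a single triad class `μ`, unfolded. [cite: Tao2016AveragedNS, §4 (4.3); cell vocabulary, shift-set parametrised] -/
theorem fullSumOn_singleton (μ : ℤ × ℤ × ℤ) (ε₀ : ℝ) (α : Fin m → Fin m → Fin m → ℤ × ℤ × ℤ → ℝ)
    (X : Fin m → ℤ → ℝ → ℝ) (n : ℤ) (t : ℝ) :
    fullSumOn {μ} ε₀ α X n t = ∑ i₁, ∑ i₂, ∑ i₃, α i₁ i₂ i₃ μ * (1 + ε₀) ^ ((5 : ℝ) * n / 2) *
      (X i₁ (n + μ.1) t * X i₂ (n + μ.2.1) t * X i₃ (n + μ.2.2) t) := by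
  simp only [fullSumOn, Finset.sum_singleton]

/-- The cubic sum over `𝕋` is the sum of the cubic sums of its triad classes. [cite: Tao2016AveragedNS, §4 (4.3) and proof of Lemma 4.1 (v); cell vocabulary, shift-set parametrised] -/
theorem fullSumOn_eq_sum (𝕋 : Finset (ℤ × ℤ × ℤ)) (ε₀ : ℝ)
    (α : Fin m → Fin m → Fin m → ℤ × ℤ × ℤ → ℝ) (X : Fin m → ℤ → ℝ → ℝ) (n : ℤ) (t : ℝ) :
    fullSumOn 𝕋 ε₀ α X n t = ∑ μ ∈ 𝕋, fullSumOn {μ} ε₀ α X n t := by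
  simp only [fullSumOn, Finset.sum_singleton]
  symm
  rw [Finset.sum_comm]
  refine Finset.sum_congr rfl fun i₁ _ => ?_
  rw [Finset.sum_comm]
  refine Finset.sum_congr rfl fun i₂ _ => ?_
  rw [Finset.sum_comm]

/-- The cubic sum is additive over disjoint families of shifts. [cite: Tao2016AveragedNS, §4 (4.3) and proof of Lemma 4.1 (v); cell vocabulary, shift-set parametrised] -/
theorem fullSumOn_union {𝕊 𝕋 : Finset (ℤ × ℤ × ℤ)} (h : Disjoint 𝕊 𝕋) (ε₀ : ℝ)
    (α : Fin m → Fin m → Fin m → ℤ × ℤ × ℤ → ℝ) (X : Fin m → ℤ → ℝ → ℝ) (n : ℤ) (t : ℝ) :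
    fullSumOn (𝕊 ∪ 𝕋) ε₀ α X n t = fullSumOn 𝕊 ε₀ α X n t + fullSumOn 𝕋 ε₀ α X n t := by
  simp only [fullSumOn, Finset.sum_union h, Finset.sum_add_distrib]

/-- Splitting the cubic sum over `𝕊` by a predicate on the shifts. [cite: Tao2016AveragedNS, §4 (4.3) and proof of Lemma 4.1 (v); cell vocabulary, shift-set parametrised] -/
theorem fullSumOn_filter_add_filter_not (𝕊 : Finset (ℤ × ℤ × ℤ)) (p : ℤ × ℤ × ℤ → Prop)
    [DecidablePred p] (ε₀ : ℝ) (α : Fin m → Fin m → Fin m → ℤ × ℤ × ℤ → ℝ)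
    (X : Fin m → ℤ → ℝ → ℝ) (n : ℤ) (t : ℝ) :
    fullSumOn (𝕊.filter p) ε₀ α X n t + fullSumOn (𝕊.filter fun μ => ¬ p μ) ε₀ α X n t =
      fullSumOn 𝕊 ε₀ α X n t := by
  simp only [fullSumOn, ← Finset.sum_add_distrib, Finset.sum_filter_add_sum_filter_not]

/-- `F_𝕊(n) = A_𝕊(n) + B_𝕊(n)` when every output slot of `𝕊` is `0` or `1`.
[cite: Tao2016AveragedNS, §4 proof of Lemma 4.1 (v); cell vocabulary, shift-set parametrised] -/
theorem fullSumOn_eq_topSumOn_add_botSumOn {𝕊 : Finset (ℤ × ℤ × ℤ)}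
    (h𝕊 : ∀ μ ∈ 𝕊, μ.2.2 = 0 ∨ μ.2.2 = 1) (ε₀ : ℝ) (α : Fin m → Fin m → Fin m → ℤ × ℤ × ℤ → ℝ)
    (X : Fin m → ℤ → ℝ → ℝ) (n : ℤ) (t : ℝ) :
    fullSumOn 𝕊 ε₀ α X n t = topSumOn 𝕊 ε₀ α X n t + botSumOn 𝕊 ε₀ α X n t := by
  have hfilt : botShifts 𝕊 = 𝕊.filter fun μ => ¬ μ.2.2 = 0 :=
    Finset.filter_congr fun μ hμ => by rcases h𝕊 μ hμ with h | h <;> simp [h]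
  rw [topSumOn, botSumOn, hfilt, topShifts, fullSumOn_filter_add_filter_not]

/-! ### The shapes on `S` and on `S♭`; bridges to the tree's one-way sums -/

/-- The three **backscatter** classes of `S♭`: two slots on the upper shell, one on the lower.
[cite: Tao2016AveragedNS, §4 after (4.1) and p. 9 footnote 7; cell vocabulary, shift-set parametrised] -/
def backscatterShifts : Finset (ℤ × ℤ × ℤ) :=
  {(1, 1, 0), (1, 0, 1), (0, 1, 1)}

/-- `S♭ = S ∪ {(1,1,0),(1,0,1),(0,1,1)}`. [cite: Tao2016AveragedNS, §4 after (4.1) and p. 9 footnote 7; cell vocabulary, shift-set parametrised] -/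
theorem shiftSetFlat_eq_union : shiftSetFlat = shiftSet ∪ backscatterShifts := by
  decide

/-- `S` and the backscatter classes are disjoint. [cite: Tao2016AveragedNS, §4 after (4.1); cell vocabulary, shift-set parametrised] -/
theorem disjoint_shiftSet_backscatterShifts : Disjoint shiftSet backscatterShifts := by
  decide

/-- The backscatter classes are the images of one another under slot permutations: they form a
slot-closed family on their own. [cite: Tao2016AveragedNS, §4 (4.3); cell vocabulary, shift-set parametrised] -/
theorem isSlotClosed_backscatterShifts : IsSlotClosed backscatterShifts := by
  unfold IsSlotClosed
  decide

/-- The backscatter classes are nearest-neighbour. [cite: Tao2016AveragedNS, §4 after (4.1); cell vocabulary, shift-set parametrised] -/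
theorem isNearestNeighbourSet_backscatterShifts : IsNearestNeighbourSet backscatterShifts := by
  unfold IsNearestNeighbourSet
  decide

/-- On `S` the same-shell classes are `(0,0,0), (1,0,0), (0,1,0)`. [cite: Tao2016AveragedNS, §4 proof of Lemma 4.1 (v); cell vocabulary, shift-set parametrised] -/
theorem topShifts_shiftSet : topShifts shiftSet = {(0, 0, 0), (1, 0, 0), (0, 1, 0)} := by
  decide

/-- On `S` the only bond-crossing class is `(0,0,1)`. [cite: Tao2016AveragedNS, §4 proof of Lemma 4.1 (v); cell vocabulary, shift-set parametrised] -/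
theorem botShifts_shiftSet : botShifts shiftSet = {((0 : ℤ), (0 : ℤ), (1 : ℤ))} := by
  decide

/-- On `S♭` the same-shell classes are `(0,0,0), (1,0,0), (0,1,0)` and the backscatter class
`(1,1,0)`. [cite: Tao2016AveragedNS, §4 after (4.1) and p. 9 footnote 7; cell vocabulary, shift-set parametrised] -/
theorem topShifts_shiftSetFlat :
    topShifts shiftSetFlat = {(0, 0, 0), (1, 0, 0), (0, 1, 0), (1, 1, 0)} := by
  decide

/-- On `S♭` the bond-crossing classes are `(0,0,1), (1,0,1), (0,1,1)`.
[cite: Tao2016AveragedNS, §4 after (4.1) and p. 9 footnote 7; cell vocabulary, shift-set parametrised] -/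
theorem botShifts_shiftSetFlat :
    botShifts shiftSetFlat = {(0, 0, 1), (1, 0, 1), (0, 1, 1)} := by
  decide

/-- `fullSumOn shiftSet` is the tree's `fullSum`, definitionally. [cite: Tao2016AveragedNS, §4 (4.3); cell vocabulary, shift-set parametrised] -/
theorem fullSumOn_shiftSet (ε₀ : ℝ) (α : Fin m → Fin m → Fin m → ℤ × ℤ × ℤ → ℝ)
    (X : Fin m → ℤ → ℝ → ℝ) (n : ℤ) (t : ℝ) :
    fullSumOn shiftSet ε₀ α X n t = fullSum ε₀ α X n t := rfl

/-- `botSumOn shiftSet` is the tree's one-way bond flux `botSum`. [cite: Tao2016AveragedNS, §4 proof of Lemma 4.1 (v); cell vocabulary, shift-set parametrised] -/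
theorem botSumOn_shiftSet (ε₀ : ℝ) (α : Fin m → Fin m → Fin m → ℤ × ℤ × ℤ → ℝ)
    (X : Fin m → ℤ → ℝ → ℝ) (n : ℤ) (t : ℝ) :
    botSumOn shiftSet ε₀ α X n t = botSum ε₀ α X n t := by
  rw [botSumOn, botShifts_shiftSet]
  simp only [fullSumOn, botSum, Finset.sum_singleton, add_zero]

/-- `topSumOn shiftSet` is the tree's `topSum`. [cite: Tao2016AveragedNS, §4 proof of Lemma 4.1 (v); cell vocabulary, shift-set parametrised] -/
theorem topSumOn_shiftSet (ε₀ : ℝ) (α : Fin m → Fin m → Fin m → ℤ × ℤ × ℤ → ℝ)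
    (X : Fin m → ℤ → ℝ → ℝ) (n : ℤ) (t : ℝ) :
    topSumOn shiftSet ε₀ α X n t = topSum ε₀ α X n t := by
  rw [topSumOn, topShifts_shiftSet]
  simp only [fullSumOn, topSum]
  refine Finset.sum_congr rfl fun i₁ _ => Finset.sum_congr rfl fun i₂ _ =>
    Finset.sum_congr rfl fun i₃ _ => ?_
  rw [Finset.sum_insert (by decide), Finset.sum_insert (by decide), Finset.sum_singleton]
  simp only [add_zero]
  ring

/-- On `S♭` the cubic sum is the one-way cubic sum plus the backscatter part.
[cite: Tao2016AveragedNS, §4 (4.3) and p. 9 footnote 7; cell vocabulary, shift-set parametrised] -/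
theorem fullSumOn_shiftSetFlat (ε₀ : ℝ) (α : Fin m → Fin m → Fin m → ℤ × ℤ × ℤ → ℝ)
    (X : Fin m → ℤ → ℝ → ℝ) (n : ℤ) (t : ℝ) :
    fullSumOn shiftSetFlat ε₀ α X n t =
      fullSum ε₀ α X n t + fullSumOn backscatterShifts ε₀ α X n t := by
  rw [shiftSetFlat_eq_union, fullSumOn_union disjoint_shiftSet_backscatterShifts, fullSumOn_shiftSet]

/-- On `S♭` the bond flux is the one-way flux `botSum` plus the two bond-crossing backscatter terms
(classes `(1,0,1)` and `(0,1,1)`, each with two slots on the upper shell).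
[cite: Tao2016AveragedNS, §4 proof of Lemma 4.1 (v) and p. 9 footnote 7; cell vocabulary, shift-set parametrised] -/
theorem botSumOn_shiftSetFlat (ε₀ : ℝ) (α : Fin m → Fin m → Fin m → ℤ × ℤ × ℤ → ℝ)
    (X : Fin m → ℤ → ℝ → ℝ) (n : ℤ) (t : ℝ) :
    botSumOn shiftSetFlat ε₀ α X n t =
      botSum ε₀ α X n t + fullSumOn {((1 : ℤ), (0 : ℤ), (1 : ℤ)), (0, 1, 1)} ε₀ α X n t := by
  have hsplit : ({(0, 0, 1), (1, 0, 1), (0, 1, 1)} : Finset (ℤ × ℤ × ℤ)) =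
      {((0 : ℤ), (0 : ℤ), (1 : ℤ))} ∪ {((1 : ℤ), (0 : ℤ), (1 : ℤ)), (0, 1, 1)} := by
    decide
  rw [botSumOn, botShifts_shiftSetFlat, hsplit, fullSumOn_union (by decide), ← botSumOn_shiftSet,
    botSumOn, botShifts_shiftSet]

/-- On `S♭` the same-shell sum is the one-way `topSum` plus the backscatter term of class `(1,1,0)`.
[cite: Tao2016AveragedNS, §4 proof of Lemma 4.1 (v) and p. 9 footnote 7; cell vocabulary, shift-set parametrised] -/
theorem topSumOn_shiftSetFlat (ε₀ : ℝ) (α : Fin m → Fin m → Fin m → ℤ × ℤ × ℤ → ℝ)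
    (X : Fin m → ℤ → ℝ → ℝ) (n : ℤ) (t : ℝ) :
    topSumOn shiftSetFlat ε₀ α X n t =
      topSum ε₀ α X n t + fullSumOn {((1 : ℤ), (1 : ℤ), (0 : ℤ))} ε₀ α X n t := by
  have hsplit : ({(0, 0, 0), (1, 0, 0), (0, 1, 0), (1, 1, 0)} : Finset (ℤ × ℤ × ℤ)) =
      {((0 : ℤ), (0 : ℤ), (0 : ℤ)), (1, 0, 0), (0, 1, 0)} ∪ {((1 : ℤ), (1 : ℤ), (0 : ℤ))} := by
    decide
  rw [topSumOn, topShifts_shiftSetFlat, hsplit, fullSumOn_union (by decide), ← topSumOn_shiftSet,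
    topSumOn, topShifts_shiftSet]

/-- The backscatter term of class `(1,1,0)` explicitly: two factors on the UPPER shell `n+1`, the
output factor on the lower shell `n`. [cite: Tao2016AveragedNS, §4 after (4.1) and p. 9 footnote 7; cell vocabulary, shift-set parametrised] -/
theorem fullSumOn_backscatter₁₁₀ (ε₀ : ℝ) (α : Fin m → Fin m → Fin m → ℤ × ℤ × ℤ → ℝ)
    (X : Fin m → ℤ → ℝ → ℝ) (n : ℤ) (t : ℝ) :
    fullSumOn {((1 : ℤ), (1 : ℤ), (0 : ℤ))} ε₀ α X n t =
      ∑ i₁, ∑ i₂, ∑ i₃, α i₁ i₂ i₃ (1, 1, 0) * (1 + ε₀) ^ ((5 : ℝ) * n / 2) *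
        (X i₁ (n + 1) t * X i₂ (n + 1) t * X i₃ n t) := by
  simp only [fullSumOn_singleton, add_zero]

/-! ### The energy nonlinearity summed over the modes -/

/-- **Shape-free form of the summed energy nonlinearity**: for ANY shift set,
`∑ᵢ quadTermOn 𝕊 _{i,n} · X_{i,n} = ∑_{μ ∈ 𝕊} F_{{μ}}(n - μ₃)` — the class `μ` contributes its cubic
term based at the shell `n - μ₃` (the output slot is at `n`).
[cite: Tao2016AveragedNS, §4 proof of Lemma 4.1 (v); cell vocabulary, shift-set parametrised] -/
theorem sum_quadTermOn_mul_eq_sum (𝕊 : Finset (ℤ × ℤ × ℤ)) (ε₀ : ℝ)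
    (α : Fin m → Fin m → Fin m → ℤ × ℤ × ℤ → ℝ) (X : Fin m → ℤ → ℝ → ℝ) (n : ℤ) (t : ℝ) :
    ∑ i, quadTermOn 𝕊 ε₀ α X i n t * X i n t =
      ∑ μ ∈ 𝕊, fullSumOn {μ} ε₀ α X (n - μ.2.2) t := by
  simp only [quadTermOn, fullSumOn, Finset.sum_singleton, Finset.sum_mul, sub_add_cancel, Int.cast_sub]
  conv_lhs => rw [Finset.sum_comm]
  conv_rhs => rw [Finset.sum_comm]
  refine Finset.sum_congr rfl fun i₁ _ => ?_
  conv_lhs => rw [Finset.sum_comm]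
  conv_rhs => rw [Finset.sum_comm]
  refine Finset.sum_congr rfl fun i₂ _ => ?_
  conv_lhs => rw [Finset.sum_comm]
  refine Finset.sum_congr rfl fun μ _ => Finset.sum_congr rfl fun i₃ _ => ?_
  ring

/-- **The energy nonlinearity, summed over the modes, splits by the output shell**: when every
output slot of `𝕊` is `0` or `1`, `∑ᵢ quadTermOn 𝕊 _{i,n} · X_{i,n} = A_𝕊(n) + B_𝕊(n-1)`
(the tree's `sum_quadTerm_mul` for `S`). [cite: Tao2016AveragedNS, §4 proof of Lemma 4.1 (v); cell vocabulary, shift-set parametrised] -/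
theorem sum_quadTermOn_mul {𝕊 : Finset (ℤ × ℤ × ℤ)} (h𝕊 : ∀ μ ∈ 𝕊, μ.2.2 = 0 ∨ μ.2.2 = 1)
    (ε₀ : ℝ) (α : Fin m → Fin m → Fin m → ℤ × ℤ × ℤ → ℝ) (X : Fin m → ℤ → ℝ → ℝ) (n : ℤ)
    (t : ℝ) :
    ∑ i, quadTermOn 𝕊 ε₀ α X i n t * X i n t =
      topSumOn 𝕊 ε₀ α X n t + botSumOn 𝕊 ε₀ α X (n - 1) t := by
  have hfilt : (𝕊.filter fun μ => ¬ μ.2.2 = 0) = botShifts 𝕊 :=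
    Finset.filter_congr fun μ hμ => by rcases h𝕊 μ hμ with h | h <;> simp [h]
  rw [sum_quadTermOn_mul_eq_sum, topSumOn, botSumOn, fullSumOn_eq_sum (topShifts 𝕊),
    fullSumOn_eq_sum (botShifts 𝕊),
    ← Finset.sum_filter_add_sum_filter_not 𝕊 (fun μ => μ.2.2 = 0), hfilt, topShifts]
  congr 1
  · refine Finset.sum_congr rfl fun μ hμ => ?_
    rw [(Finset.mem_filter.1 hμ).2, sub_zero]
  · refine Finset.sum_congr rfl fun μ hμ => ?_
    rw [(Finset.mem_filter.1 hμ).2]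

/-! ### Conservation: the cubic sum vanishes under (4.3) -/

/-- **The cubic sum over a slot-closed shift set vanishes under the cancellation condition (4.3) on
it**: `F_𝕊(n) = 0` for every scale `n` (the product `X_{i₁,n+μ₁} X_{i₂,n+μ₂} X_{i₃,n+μ₃}` is
invariant under permuting the three index pairs, so relabelling the finite sum by the six
permutations — which map `𝕊` to itself — and adding gives `6 F_𝕊(n) = ∑ (∑_perm α_perm) · XXX = 0`;
Tao p. 22: "all the terms here can be grouped into terms that sum to zero"). Applied to a slot-closed
SUB-family on which `α` cancels (e.g. one permutation class of shifts) it is the class-wise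
conservation. [cite: Tao2016AveragedNS, §4 (4.3) and proof of Lemma 4.1 (v); cell vocabulary, shift-set parametrised] -/
theorem fullSumOn_eq_zero {𝕊 : Finset (ℤ × ℤ × ℤ)} (h𝕊 : IsSlotClosed 𝕊) (ε₀ : ℝ)
    {α : Fin m → Fin m → Fin m → ℤ × ℤ × ℤ → ℝ} (hα : IsCancellingCoeffOn 𝕊 α)
    (X : Fin m → ℤ → ℝ → ℝ) (n : ℤ) (t : ℝ) :
    fullSumOn 𝕊 ε₀ α X n t = 0 := by
  -- the slot-symmetric products
  set T : Fin m → ℤ → Fin m → ℤ → Fin m → ℤ → ℝ := fun a x b y c z =>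
    (1 + ε₀) ^ ((5 : ℝ) * n / 2) * (X a (n + x) t * X b (n + y) t * X c (n + z) t) with hT
  have T₁₂ : ∀ a x b y c z, T b y a x c z = T a x b y c z := fun a x b y c z => by
    simp only [hT]; ring
  have T₂₃ : ∀ a x b y c z, T a x c z b y = T a x b y c z := fun a x b y c z => by
    simp only [hT]; ring
  set SF : (Fin m → Fin m → Fin m → ℤ × ℤ × ℤ → ℝ) → ℝ := fun β =>
    ∑ i₁, ∑ i₂, ∑ i₃, ∑ μ ∈ 𝕊, β i₁ i₂ i₃ μ * T i₁ μ.1 i₂ μ.2.1 i₃ μ.2.2 with hSF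
  have hform : fullSumOn 𝕊 ε₀ α X n t = SF α := by
    simp only [fullSumOn, hSF, hT]
    refine Finset.sum_congr rfl fun i₁ _ => Finset.sum_congr rfl fun i₂ _ =>
      Finset.sum_congr rfl fun i₃ _ => Finset.sum_congr rfl fun μ _ => ?_
    ring
  have e₁₂ : ∀ β : Fin m → Fin m → Fin m → ℤ × ℤ × ℤ → ℝ,
      SF (fun i₁ i₂ i₃ μ => β i₂ i₁ i₃ (μ.2.1, μ.1, μ.2.2)) = SF β := fun β => by
    simp only [hSF]
    rw [h𝕊.sum_slots_swap₁₂ (fun i₁ i₂ i₃ μ => β i₁ i₂ i₃ μ * T i₁ μ.1 i₂ μ.2.1 i₃ μ.2.2)]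
    refine Finset.sum_congr rfl fun i₁ _ => Finset.sum_congr rfl fun i₂ _ =>
      Finset.sum_congr rfl fun i₃ _ => Finset.sum_congr rfl fun μ _ => ?_
    rw [T₁₂]
  have e₂₃ : ∀ β : Fin m → Fin m → Fin m → ℤ × ℤ × ℤ → ℝ,
      SF (fun i₁ i₂ i₃ μ => β i₁ i₃ i₂ (μ.1, μ.2.2, μ.2.1)) = SF β := fun β => by
    simp only [hSF]
    rw [h𝕊.sum_slots_swap₂₃ (fun i₁ i₂ i₃ μ => β i₁ i₂ i₃ μ * T i₁ μ.1 i₂ μ.2.1 i₃ μ.2.2)]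
    refine Finset.sum_congr rfl fun i₁ _ => Finset.sum_congr rfl fun i₂ _ =>
      Finset.sum_congr rfl fun i₃ _ => Finset.sum_congr rfl fun μ _ => ?_
    rw [T₂₃]
  have h₂ : SF (fun i₁ i₂ i₃ μ => α i₂ i₁ i₃ (μ.2.1, μ.1, μ.2.2)) = SF α := e₁₂ α
  have h₃ : SF (fun i₁ i₂ i₃ μ => α i₁ i₃ i₂ (μ.1, μ.2.2, μ.2.1)) = SF α := e₂₃ α
  have h₄ : SF (fun i₁ i₂ i₃ μ => α i₂ i₃ i₁ (μ.2.1, μ.2.2, μ.1)) = SF α := by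
    rw [← h₃]
    exact e₁₂ (fun i₁ i₂ i₃ μ => α i₁ i₃ i₂ (μ.1, μ.2.2, μ.2.1))
  have h₅ : SF (fun i₁ i₂ i₃ μ => α i₃ i₁ i₂ (μ.2.2, μ.1, μ.2.1)) = SF α := by
    rw [← h₂]
    exact e₂₃ (fun i₁ i₂ i₃ μ => α i₂ i₁ i₃ (μ.2.1, μ.1, μ.2.2))
  have h₆ : SF (fun i₁ i₂ i₃ μ => α i₃ i₂ i₁ (μ.2.2, μ.2.1, μ.1)) = SF α := by
    rw [← h₄]
    exact e₂₃ (fun i₁ i₂ i₃ μ => α i₂ i₃ i₁ (μ.2.1, μ.2.2, μ.1))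
  have hexp : ∀ β₁ β₂ : Fin m → Fin m → Fin m → ℤ × ℤ × ℤ → ℝ,
      SF (fun i₁ i₂ i₃ μ => β₁ i₁ i₂ i₃ μ + β₂ i₁ i₂ i₃ μ) = SF β₁ + SF β₂ := fun β₁ β₂ => by
    simp only [hSF, add_mul, Finset.sum_add_distrib]
  have hsum : (6 : ℝ) * SF α =
      SF (fun i₁ i₂ i₃ μ => α i₁ i₂ i₃ μ + α i₁ i₃ i₂ (μ.1, μ.2.2, μ.2.1) +
        α i₂ i₁ i₃ (μ.2.1, μ.1, μ.2.2) + α i₂ i₃ i₁ (μ.2.1, μ.2.2, μ.1) +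
        α i₃ i₁ i₂ (μ.2.2, μ.1, μ.2.1) + α i₃ i₂ i₁ (μ.2.2, μ.2.1, μ.1)) := by
    rw [hexp, hexp, hexp, hexp, hexp, h₂, h₃, h₄, h₅, h₆]
    ring
  have hzero : SF (fun i₁ i₂ i₃ μ => α i₁ i₂ i₃ μ + α i₁ i₃ i₂ (μ.1, μ.2.2, μ.2.1) +
        α i₂ i₁ i₃ (μ.2.1, μ.1, μ.2.2) + α i₂ i₃ i₁ (μ.2.1, μ.2.2, μ.1) +
        α i₃ i₁ i₂ (μ.2.2, μ.1, μ.2.1) + α i₃ i₂ i₁ (μ.2.2, μ.2.1, μ.1)) = 0 := by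
    simp only [hSF]
    refine Finset.sum_eq_zero fun i₁ _ => Finset.sum_eq_zero fun i₂ _ =>
      Finset.sum_eq_zero fun i₃ _ => Finset.sum_eq_zero fun μ hμ => ?_
    have h := hα i₁ i₂ i₃ μ.1 μ.2.1 μ.2.2 (by simpa using hμ)
    simp only [Prod.mk.eta] at h
    rw [h, zero_mul]
  rw [hform]
  have h6 : (6 : ℝ) * SF α = 0 := hsum.trans hzero
  simpa using h6

/-- Hence `B_𝕊(n) = -A_𝕊(n)` on a slot-closed shift set with output slots in `{0,1}`: what the
base-`n` triads feed the shell `n+1` balances what they take from the shell `n`.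
[cite: Tao2016AveragedNS, §4 proof of Lemma 4.1 (v); cell vocabulary, shift-set parametrised] -/
theorem botSumOn_eq_neg_topSumOn {𝕊 : Finset (ℤ × ℤ × ℤ)} (h𝕊 : IsSlotClosed 𝕊)
    (h𝕊' : ∀ μ ∈ 𝕊, μ.2.2 = 0 ∨ μ.2.2 = 1) (ε₀ : ℝ)
    {α : Fin m → Fin m → Fin m → ℤ × ℤ × ℤ → ℝ} (hα : IsCancellingCoeffOn 𝕊 α)
    (X : Fin m → ℤ → ℝ → ℝ) (n : ℤ) (t : ℝ) :
    botSumOn 𝕊 ε₀ α X n t = -topSumOn 𝕊 ε₀ α X n t := by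
  have h := fullSumOn_eq_zero h𝕊 ε₀ hα X n t
  rw [fullSumOn_eq_topSumOn_add_botSumOn h𝕊'] at h
  linarith

/-- **Telescoping of the summed energy nonlinearity on `𝕊`**: over the scales `N, …, N+L-1`,
`∑_{k<L} ∑ᵢ quadTermOn 𝕊 _{i,N+k} X_{i,N+k} = A_𝕊(N+L-1) - A_𝕊(N-1)` (all interior scales cancel by
(4.3)). [cite: Tao2016AveragedNS, §4 proof of Lemma 4.1 (v); cell vocabulary, shift-set parametrised] -/
theorem sum_range_sum_quadTermOn_mul {𝕊 : Finset (ℤ × ℤ × ℤ)} (h𝕊 : IsSlotClosed 𝕊)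
    (h𝕊' : ∀ μ ∈ 𝕊, μ.2.2 = 0 ∨ μ.2.2 = 1) (ε₀ : ℝ)
    {α : Fin m → Fin m → Fin m → ℤ × ℤ × ℤ → ℝ} (hα : IsCancellingCoeffOn 𝕊 α)
    (X : Fin m → ℤ → ℝ → ℝ) (N : ℤ) (L : ℕ) (t : ℝ) :
    ∑ k ∈ Finset.range L, ∑ i, quadTermOn 𝕊 ε₀ α X i (N + k) t * X i (N + k) t =
      topSumOn 𝕊 ε₀ α X (N + L - 1) t - topSumOn 𝕊 ε₀ α X (N - 1) t := by
  have h : ∀ k : ℕ, ∑ i, quadTermOn 𝕊 ε₀ α X i (N + k) t * X i (N + k) t =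
      topSumOn 𝕊 ε₀ α X (N + (k + 1 : ℕ) - 1) t - topSumOn 𝕊 ε₀ α X (N + k - 1) t := fun k => by
    rw [sum_quadTermOn_mul h𝕊', botSumOn_eq_neg_topSumOn h𝕊 h𝕊' ε₀ hα]
    push_cast
    ring_nf
  simp_rw [h]
  rw [Finset.sum_range_sub (fun k : ℕ => topSumOn 𝕊 ε₀ α X (N + k - 1) t) L]
  simp

/-- **The block form of the telescoping**: under (4.3) the summed energy nonlinearity of the block
of shells `K, …, K+L-1` is the bond flux in at the bottom minus the bond flux out at the top,
`∑_{k<L} ∑ᵢ quadTermOn 𝕊 _{i,K+k} X_{i,K+k} = B_𝕊(K-1) - B_𝕊(K+L-1)`.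
[cite: Tao2016AveragedNS, §4 proof of Lemma 4.1 (v); cell vocabulary, shift-set parametrised] -/
theorem sum_range_sum_quadTermOn_mul_eq_botSumOn {𝕊 : Finset (ℤ × ℤ × ℤ)} (h𝕊 : IsSlotClosed 𝕊)
    (h𝕊' : ∀ μ ∈ 𝕊, μ.2.2 = 0 ∨ μ.2.2 = 1) (ε₀ : ℝ)
    {α : Fin m → Fin m → Fin m → ℤ × ℤ × ℤ → ℝ} (hα : IsCancellingCoeffOn 𝕊 α)
    (X : Fin m → ℤ → ℝ → ℝ) (K : ℤ) (L : ℕ) (t : ℝ) :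
    ∑ k ∈ Finset.range L, ∑ i, quadTermOn 𝕊 ε₀ α X i (K + k) t * X i (K + k) t =
      botSumOn 𝕊 ε₀ α X (K - 1) t - botSumOn 𝕊 ε₀ α X (K + L - 1) t := by
  rw [sum_range_sum_quadTermOn_mul h𝕊 h𝕊' ε₀ hα X K L t, botSumOn_eq_neg_topSumOn h𝕊 h𝕊' ε₀ hα,
    botSumOn_eq_neg_topSumOn h𝕊 h𝕊' ε₀ hα]
  ring

/-! ### Conservation on `S♭`, class by class, and the bond flux there -/

/-- On `S♭`, cancellation restricts to Tao's `S`, so the one-way cubic sum still vanishes.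
[cite: Tao2016AveragedNS, §4 (4.3); cell vocabulary, shift-set parametrised] -/
theorem fullSum_eq_zero_of_shiftSetFlat (ε₀ : ℝ) {α : Fin m → Fin m → Fin m → ℤ × ℤ × ℤ → ℝ}
    (hα : IsCancellingCoeffOn shiftSetFlat α) (X : Fin m → ℤ → ℝ → ℝ) (n : ℤ) (t : ℝ) :
    fullSum ε₀ α X n t = 0 :=
  fullSum_eq_zero ε₀ ((isCancellingCoeffOn_shiftSet_iff α).1 (hα.mono shiftSet_subset_shiftSetFlat))
    X n t

/-- **Class-wise conservation on `S♭`**: the cubic sum of the three backscatter classes vanishes on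
its own under (4.3) on `S♭` (they form a slot-closed family).
[cite: Tao2016AveragedNS, §4 (4.3) and proof of Lemma 4.1 (v); cell vocabulary, shift-set parametrised] -/
theorem fullSumOn_backscatterShifts_eq_zero (ε₀ : ℝ)
    {α : Fin m → Fin m → Fin m → ℤ × ℤ × ℤ → ℝ} (hα : IsCancellingCoeffOn shiftSetFlat α)
    (X : Fin m → ℤ → ℝ → ℝ) (n : ℤ) (t : ℝ) :
    fullSumOn backscatterShifts ε₀ α X n t = 0 :=
  fullSumOn_eq_zero isSlotClosed_backscatterShifts ε₀
    (hα.mono (by rw [shiftSetFlat_eq_union]; exact Finset.subset_union_right)) X n t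

/-- Total conservation on `S♭`: `F_{S♭}(n) = 0` under (4.3) on `S♭`.
[cite: Tao2016AveragedNS, §4 (4.3) and proof of Lemma 4.1 (v); cell vocabulary, shift-set parametrised] -/
theorem fullSumOn_shiftSetFlat_eq_zero (ε₀ : ℝ)
    {α : Fin m → Fin m → Fin m → ℤ × ℤ × ℤ → ℝ} (hα : IsCancellingCoeffOn shiftSetFlat α)
    (X : Fin m → ℤ → ℝ → ℝ) (n : ℤ) (t : ℝ) :
    fullSumOn shiftSetFlat ε₀ α X n t = 0 :=
  fullSumOn_eq_zero isSlotClosed_shiftSetFlat ε₀ hα X n t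

/-- **The bond flux on `S♭` under (4.3)**: through the bond `n | n+1` the flux is the one-way flux
`botSum(n)` (quadratic in the shell `n` below the bond, linear in the shell `n+1`) MINUS the
backscatter cubic term of class `(1,1,0)` (quadratic in the shell `n+1` ABOVE the bond, linear in the
shell `n`): `B_{S♭}(n) = botSum(n) - F_{{(1,1,0)}}(n)`. The second term is what breaks the
one-directional energy bookkeeping of `S`. [cite: Tao2016AveragedNS, §4 proof of Lemma 4.1 (v) and p. 9 footnote 7; cell vocabulary, shift-set parametrised] -/
theorem botSumOn_shiftSetFlat_eq_botSum_sub (ε₀ : ℝ)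
    {α : Fin m → Fin m → Fin m → ℤ × ℤ × ℤ → ℝ} (hα : IsCancellingCoeffOn shiftSetFlat α)
    (X : Fin m → ℤ → ℝ → ℝ) (n : ℤ) (t : ℝ) :
    botSumOn shiftSetFlat ε₀ α X n t =
      botSum ε₀ α X n t - fullSumOn {((1 : ℤ), (1 : ℤ), (0 : ℤ))} ε₀ α X n t := by
  have h0 := fullSumOn_backscatterShifts_eq_zero ε₀ hα X n t
  have hsplit : backscatterShifts =
      {((1 : ℤ), (1 : ℤ), (0 : ℤ))} ∪ {((1 : ℤ), (0 : ℤ), (1 : ℤ)), (0, 1, 1)} := by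
    decide
  rw [hsplit, fullSumOn_union (by decide)] at h0
  rw [botSumOn_shiftSetFlat]
  linarith

/-- Over a block of shells on `S♭` under (4.3): `∑_{k<L} ∑ᵢ quadTermOn S♭ · X (K+k)` equals
`(botSum(K-1) - F_{{(1,1,0)}}(K-1)) - (botSum(K+L-1) - F_{{(1,1,0)}}(K+L-1))` — the one-way fluxes
at the two bonds corrected by the backscatter terms, each quadratic in the shell above its bond.
[cite: Tao2016AveragedNS, §4 proof of Lemma 4.1 (v) and p. 9 footnote 7; cell vocabulary, shift-set parametrised] -/
theorem sum_range_sum_quadTermOn_mul_shiftSetFlat (ε₀ : ℝ)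
    {α : Fin m → Fin m → Fin m → ℤ × ℤ × ℤ → ℝ} (hα : IsCancellingCoeffOn shiftSetFlat α)
    (X : Fin m → ℤ → ℝ → ℝ) (K : ℤ) (L : ℕ) (t : ℝ) :
    ∑ k ∈ Finset.range L, ∑ i, quadTermOn shiftSetFlat ε₀ α X i (K + k) t * X i (K + k) t =
      (botSum ε₀ α X (K - 1) t - fullSumOn {((1 : ℤ), (1 : ℤ), (0 : ℤ))} ε₀ α X (K - 1) t) -
        (botSum ε₀ α X (K + L - 1) t -
          fullSumOn {((1 : ℤ), (1 : ℤ), (0 : ℤ))} ε₀ α X (K + L - 1) t) := by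
  rw [sum_range_sum_quadTermOn_mul_eq_botSumOn isSlotClosed_shiftSetFlat
    isNearestNeighbourSet_shiftSetFlat.out_eq_zero_or_one ε₀ hα X K L t,
    botSumOn_shiftSetFlat_eq_botSum_sub ε₀ hα, botSumOn_shiftSetFlat_eq_botSum_sub ε₀ hα]

/-! ### Two-sided size of the cubic sums on a nearest-neighbour family -/

/-- **Size of a cubic sum from slot-wise amplitude bounds**: if `B ≥ 0` bounds the amplitudes on the
shells met by the triads of `𝕋` based at `n` (`|X_{i,n+μⱼ}| ≤ B(n+μⱼ)` for `μ ∈ 𝕋`), then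
`|F_𝕋(n)| ≤ (1+ε₀)^{5n/2} ∑_{i,μ ∈ 𝕋} |α_{i,μ}| B(n+μ₁) B(n+μ₂) B(n+μ₃)`.
[cite: Tao2016AveragedNS, §4 proof of Lemma 4.1 (v) (the boundary terms); cell vocabulary, shift-set parametrised] -/
theorem abs_fullSumOn_le_of_slot_bounds {𝕋 : Finset (ℤ × ℤ × ℤ)} (ε₀ : ℝ) (hε : 0 < 1 + ε₀)
    (α : Fin m → Fin m → Fin m → ℤ × ℤ × ℤ → ℝ) (X : Fin m → ℤ → ℝ → ℝ) (n : ℤ) (t : ℝ)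
    {B : ℤ → ℝ} (hB : ∀ k, 0 ≤ B k)
    (hX : ∀ μ ∈ 𝕋, ∀ i, |X i (n + μ.1) t| ≤ B (n + μ.1) ∧ |X i (n + μ.2.1) t| ≤ B (n + μ.2.1) ∧
      |X i (n + μ.2.2) t| ≤ B (n + μ.2.2)) :
    |fullSumOn 𝕋 ε₀ α X n t| ≤ (1 + ε₀) ^ ((5 : ℝ) * n / 2) *
      ∑ i₁, ∑ i₂, ∑ i₃, ∑ μ ∈ 𝕋, |α i₁ i₂ i₃ μ| * (B (n + μ.1) * B (n + μ.2.1) * B (n + μ.2.2)) := by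
  set s : ℝ := (1 + ε₀) ^ ((5 : ℝ) * n / 2) with hs
  have hc : 0 ≤ s := (Real.rpow_pos_of_pos hε _).le
  unfold fullSumOn
  rw [← hs]
  simp only [Finset.mul_sum]
  refine (Finset.abs_sum_le_sum_abs _ _).trans (Finset.sum_le_sum fun i₁ _ => ?_)
  refine (Finset.abs_sum_le_sum_abs _ _).trans (Finset.sum_le_sum fun i₂ _ => ?_)
  refine (Finset.abs_sum_le_sum_abs _ _).trans (Finset.sum_le_sum fun i₃ _ => ?_)
  refine (Finset.abs_sum_le_sum_abs _ _).trans (Finset.sum_le_sum fun μ hμ => ?_)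
  have hprod : |X i₁ (n + μ.1) t * X i₂ (n + μ.2.1) t * X i₃ (n + μ.2.2) t| ≤
      B (n + μ.1) * B (n + μ.2.1) * B (n + μ.2.2) := by
    rw [abs_mul, abs_mul]
    exact mul_le_mul (mul_le_mul (hX μ hμ i₁).1 (hX μ hμ i₂).2.1 (abs_nonneg _) (hB _))
      (hX μ hμ i₃).2.2 (abs_nonneg _) (mul_nonneg (hB _) (hB _))
  calc |α i₁ i₂ i₃ μ * s * (X i₁ (n + μ.1) t * X i₂ (n + μ.2.1) t * X i₃ (n + μ.2.2) t)|
      = |α i₁ i₂ i₃ μ| * s * |X i₁ (n + μ.1) t * X i₂ (n + μ.2.1) t * X i₃ (n + μ.2.2) t| := by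
        rw [abs_mul, abs_mul, abs_of_nonneg hc]
    _ ≤ |α i₁ i₂ i₃ μ| * s * (B (n + μ.1) * B (n + μ.2.1) * B (n + μ.2.2)) := by gcongr
    _ = s * (|α i₁ i₂ i₃ μ| * (B (n + μ.1) * B (n + μ.2.1) * B (n + μ.2.2))) := by ring

/-- **Size of a cubic sum on a nearest-neighbour family from one amplitude bound**: if
`|X_{i,n}|, |X_{i,n+1}| ≤ M` for all modes then `|F_𝕋(n)| ≤ (1+ε₀)^{5n/2} M³ ∑_{i,μ ∈ 𝕋} |α_{i,μ}|`.
[cite: Tao2016AveragedNS, §4 proof of Lemma 4.1 (v) (the boundary terms); cell vocabulary, shift-set parametrised] -/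
theorem abs_fullSumOn_le_of_abs_le {𝕋 : Finset (ℤ × ℤ × ℤ)} (h𝕋 : IsNearestNeighbourSet 𝕋)
    (ε₀ : ℝ) (hε : 0 < 1 + ε₀) (α : Fin m → Fin m → Fin m → ℤ × ℤ × ℤ → ℝ)
    (X : Fin m → ℤ → ℝ → ℝ) (n : ℤ) (t : ℝ) {M : ℝ} (hM : 0 ≤ M)
    (hX : ∀ i, |X i n t| ≤ M ∧ |X i (n + 1) t| ≤ M) :
    |fullSumOn 𝕋 ε₀ α X n t| ≤ (1 + ε₀) ^ ((5 : ℝ) * n / 2) * M ^ 3 * coeffAbsOn 𝕋 α := by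
  have hslot : ∀ j : ℤ, (j = 0 ∨ j = 1) → ∀ i, |X i (n + j) t| ≤ M := by
    rintro j (rfl | rfl) i
    · simpa using (hX i).1
    · exact (hX i).2
  have h := abs_fullSumOn_le_of_slot_bounds ε₀ hε α X n t (B := fun _ => M) (fun _ => hM)
    (fun μ hμ i => ⟨hslot _ (h𝕋 μ hμ).1 i, hslot _ (h𝕋 μ hμ).2.1 i, hslot _ (h𝕋 μ hμ).2.2 i⟩)
  refine h.trans (le_of_eq ?_)
  simp only [coeffAbsOn, Finset.mul_sum]
  refine Finset.sum_congr rfl fun i₁ _ => Finset.sum_congr rfl fun i₂ _ =>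
    Finset.sum_congr rfl fun i₃ _ => Finset.sum_congr rfl fun μ _ => ?_
  ring

/-- **Two-sided energy bound for a cubic sum on a nearest-neighbour family**: if on the shells
`n, n+1` the energies are nonnegative with `½ X² ≤ E` and the amplitudes are `≤ M`, then
`|F_𝕋(n)| ≤ 2 (1+ε₀)^{5n/2} M (∑|α|) (∑ᵢ E_{i,n} + ∑ᵢ E_{i,n+1})` — two of the three factors of
every term are bounded through the energies of the two shells, the third by `M`. (On `S` the two
energy factors of the bond flux can both be taken on the LOWER shell, `abs_topSum_le_energy`; with
backscatter classes present both shells are needed.)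
[cite: Tao2016AveragedNS, §4 proof of Lemma 4.1 (v) (two factors bounded by the energies); cell vocabulary, shift-set parametrised] -/
theorem abs_fullSumOn_le_energy {𝕋 : Finset (ℤ × ℤ × ℤ)} (h𝕋 : IsNearestNeighbourSet 𝕋)
    (ε₀ : ℝ) (hε : 0 < 1 + ε₀) (α : Fin m → Fin m → Fin m → ℤ × ℤ × ℤ → ℝ)
    (X E : Fin m → ℤ → ℝ → ℝ) (n : ℤ) (t : ℝ) {M : ℝ}
    (hX : ∀ i, |X i n t| ≤ M ∧ |X i (n + 1) t| ≤ M)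
    (hE : ∀ i, 0 ≤ E i n t ∧ 0 ≤ E i (n + 1) t)
    (hXE : ∀ i, (1 / 2) * X i n t ^ 2 ≤ E i n t ∧ (1 / 2) * X i (n + 1) t ^ 2 ≤ E i (n + 1) t) :
    |fullSumOn 𝕋 ε₀ α X n t| ≤ 2 * (1 + ε₀) ^ ((5 : ℝ) * n / 2) * M * coeffAbsOn 𝕋 α *
      (∑ i, E i n t + ∑ i, E i (n + 1) t) := by
  set s : ℝ := (1 + ε₀) ^ ((5 : ℝ) * n / 2) with hs
  set W : ℝ := ∑ i, E i n t + ∑ i, E i (n + 1) t with hW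
  have hc : 0 ≤ s := (Real.rpow_pos_of_pos hε _).le
  have hEn : ∀ i, E i n t ≤ ∑ j, E j n t := fun i =>
    Finset.single_le_sum (f := fun j => E j n t) (fun j _ => (hE j).1) (Finset.mem_univ i)
  have hEn1 : ∀ i, E i (n + 1) t ≤ ∑ j, E j (n + 1) t := fun i =>
    Finset.single_le_sum (f := fun j => E j (n + 1) t) (fun j _ => (hE j).2) (Finset.mem_univ i)
  have hS0 : 0 ≤ ∑ j, E j n t := Finset.sum_nonneg fun j _ => (hE j).1
  have hS1 : 0 ≤ ∑ j, E j (n + 1) t := Finset.sum_nonneg fun j _ => (hE j).2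
  have hW0 : 0 ≤ W := add_nonneg hS0 hS1
  -- on the shells `n + j`, `j ∈ {0,1}`: amplitude, energy and defect bounds
  have hslot : ∀ j : ℤ, (j = 0 ∨ j = 1) → ∀ i,
      |X i (n + j) t| ≤ M ∧ (1 / 2) * X i (n + j) t ^ 2 ≤ W := by
    rintro j (rfl | rfl) i
    · refine ⟨by simpa using (hX i).1, ?_⟩
      have h1 := (hXE i).1
      simp only [add_zero]
      linarith [hEn i]
    · exact ⟨(hX i).2, by linarith [(hXE i).2, hEn1 i]⟩
  -- two factors through the energies, one through `M`
  have hpair : ∀ {a b : ℝ}, (1 / 2) * a ^ 2 ≤ W → (1 / 2) * b ^ 2 ≤ W → |a * b| ≤ 2 * W :=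
    fun ha hb => (abs_mul_le_half_add_sq _ _).trans (by linarith)
  have hterm : ∀ μ ∈ 𝕋, ∀ i₁ i₂ i₃ : Fin m,
      |X i₁ (n + μ.1) t * X i₂ (n + μ.2.1) t * X i₃ (n + μ.2.2) t| ≤ 2 * W * M := by
    intro μ hμ i₁ i₂ i₃
    rw [abs_mul]
    exact mul_le_mul (hpair (hslot _ (h𝕋 μ hμ).1 i₁).2 (hslot _ (h𝕋 μ hμ).2.1 i₂).2)
      (hslot _ (h𝕋 μ hμ).2.2 i₃).1 (abs_nonneg _) (mul_nonneg zero_le_two hW0)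
  have hrew : 2 * s * M * coeffAbsOn 𝕋 α * W =
      ∑ i₁, ∑ i₂, ∑ i₃, ∑ μ ∈ 𝕋, |α i₁ i₂ i₃ μ| * s * (2 * W * M) := by
    simp only [coeffAbsOn, Finset.mul_sum, Finset.sum_mul]
    refine Finset.sum_congr rfl fun i₁ _ => Finset.sum_congr rfl fun i₂ _ =>
      Finset.sum_congr rfl fun i₃ _ => Finset.sum_congr rfl fun μ _ => ?_
    ring
  unfold fullSumOn
  rw [← hs, hrew]
  refine (Finset.abs_sum_le_sum_abs _ _).trans (Finset.sum_le_sum fun i₁ _ => ?_)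
  refine (Finset.abs_sum_le_sum_abs _ _).trans (Finset.sum_le_sum fun i₂ _ => ?_)
  refine (Finset.abs_sum_le_sum_abs _ _).trans (Finset.sum_le_sum fun i₃ _ => ?_)
  refine (Finset.abs_sum_le_sum_abs _ _).trans (Finset.sum_le_sum fun μ hμ => ?_)
  calc |α i₁ i₂ i₃ μ * s * (X i₁ (n + μ.1) t * X i₂ (n + μ.2.1) t * X i₃ (n + μ.2.2) t)|
      = |α i₁ i₂ i₃ μ| * s * |X i₁ (n + μ.1) t * X i₂ (n + μ.2.1) t * X i₃ (n + μ.2.2) t| := by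
        rw [abs_mul, abs_mul, abs_of_nonneg hc]
    _ ≤ |α i₁ i₂ i₃ μ| * s * (2 * W * M) := by gcongr; exact hterm μ hμ i₁ i₂ i₃

/-- **The `(E_n + E_{n+1})^{3/2}` form of the two-sided energy bound**: taking the amplitude bound
`M = √(2 (∑ᵢ E_{i,n} + ∑ᵢ E_{i,n+1}))` supplied by `½X² ≤ E` itself,
`|F_𝕋(n)| ≤ 2 (1+ε₀)^{5n/2} (∑|α|) (E_n + E_{n+1}) √(2 (E_n + E_{n+1}))`.
[cite: Tao2016AveragedNS, §4 proof of Lemma 4.1 (v); cell vocabulary, shift-set parametrised] -/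
theorem abs_fullSumOn_le_energy_three_halves {𝕋 : Finset (ℤ × ℤ × ℤ)}
    (h𝕋 : IsNearestNeighbourSet 𝕋) (ε₀ : ℝ) (hε : 0 < 1 + ε₀)
    (α : Fin m → Fin m → Fin m → ℤ × ℤ × ℤ → ℝ) (X E : Fin m → ℤ → ℝ → ℝ) (n : ℤ) (t : ℝ)
    (hE : ∀ i, 0 ≤ E i n t ∧ 0 ≤ E i (n + 1) t)
    (hXE : ∀ i, (1 / 2) * X i n t ^ 2 ≤ E i n t ∧ (1 / 2) * X i (n + 1) t ^ 2 ≤ E i (n + 1) t) :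
    |fullSumOn 𝕋 ε₀ α X n t| ≤ 2 * (1 + ε₀) ^ ((5 : ℝ) * n / 2) * coeffAbsOn 𝕋 α *
      (∑ i, E i n t + ∑ i, E i (n + 1) t) * Real.sqrt (2 * (∑ i, E i n t + ∑ i, E i (n + 1) t)) := by
  set W : ℝ := ∑ i, E i n t + ∑ i, E i (n + 1) t with hW
  have hEn : ∀ i, E i n t ≤ ∑ j, E j n t := fun i =>
    Finset.single_le_sum (f := fun j => E j n t) (fun j _ => (hE j).1) (Finset.mem_univ i)
  have hEn1 : ∀ i, E i (n + 1) t ≤ ∑ j, E j (n + 1) t := fun i =>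
    Finset.single_le_sum (f := fun j => E j (n + 1) t) (fun j _ => (hE j).2) (Finset.mem_univ i)
  have hS0 : 0 ≤ ∑ j, E j n t := Finset.sum_nonneg fun j _ => (hE j).1
  have hS1 : 0 ≤ ∑ j, E j (n + 1) t := Finset.sum_nonneg fun j _ => (hE j).2
  have hM : ∀ i, |X i n t| ≤ Real.sqrt (2 * W) ∧ |X i (n + 1) t| ≤ Real.sqrt (2 * W) := fun i =>
    ⟨Real.abs_le_sqrt (by linarith [(hXE i).1, hEn i]),
      Real.abs_le_sqrt (by linarith [(hXE i).2, hEn1 i])⟩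
  have h := abs_fullSumOn_le_energy h𝕋 ε₀ hε α X E n t hM hE hXE
  calc |fullSumOn 𝕋 ε₀ α X n t|
      ≤ 2 * (1 + ε₀) ^ ((5 : ℝ) * n / 2) * Real.sqrt (2 * W) * coeffAbsOn 𝕋 α * W := h
    _ = 2 * (1 + ε₀) ^ ((5 : ℝ) * n / 2) * coeffAbsOn 𝕋 α * W * Real.sqrt (2 * W) := by ring

/-- The bond-crossing classes of a nearest-neighbour shift set are nearest-neighbour. [cite: Tao2016AveragedNS, §4 after (4.1) (the shift set); cell vocabulary, shift-set parametrised] -/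
theorem IsNearestNeighbourSet.botShifts {𝕊 : Finset (ℤ × ℤ × ℤ)} (h𝕊 : IsNearestNeighbourSet 𝕊) :
    IsNearestNeighbourSet (botShifts 𝕊) :=
  h𝕊.mono (Finset.filter_subset _ _)

/-- The same-shell classes of a nearest-neighbour shift set are nearest-neighbour. [cite: Tao2016AveragedNS, §4 after (4.1) (the shift set); cell vocabulary, shift-set parametrised] -/
theorem IsNearestNeighbourSet.topShifts {𝕊 : Finset (ℤ × ℤ × ℤ)} (h𝕊 : IsNearestNeighbourSet 𝕊) :
    IsNearestNeighbourSet (topShifts 𝕊) :=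
  h𝕊.mono (Finset.filter_subset _ _)

/-- **Two-sided size of the bond flux** on a nearest-neighbour shift set: with `|X| ≤ M`, `E ≥ 0`,
`½X² ≤ E` on the shells `n, n+1`,
`|B_𝕊(n)| ≤ 2 (1+ε₀)^{5n/2} M (∑_{botShifts} |α|) (∑ᵢ E_{i,n} + ∑ᵢ E_{i,n+1})`.
[cite: Tao2016AveragedNS, §4 proof of Lemma 4.1 (v); cell vocabulary, shift-set parametrised] -/
theorem abs_botSumOn_le_energy {𝕊 : Finset (ℤ × ℤ × ℤ)} (h𝕊 : IsNearestNeighbourSet 𝕊)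
    (ε₀ : ℝ) (hε : 0 < 1 + ε₀) (α : Fin m → Fin m → Fin m → ℤ × ℤ × ℤ → ℝ)
    (X E : Fin m → ℤ → ℝ → ℝ) (n : ℤ) (t : ℝ) {M : ℝ}
    (hX : ∀ i, |X i n t| ≤ M ∧ |X i (n + 1) t| ≤ M)
    (hE : ∀ i, 0 ≤ E i n t ∧ 0 ≤ E i (n + 1) t)
    (hXE : ∀ i, (1 / 2) * X i n t ^ 2 ≤ E i n t ∧ (1 / 2) * X i (n + 1) t ^ 2 ≤ E i (n + 1) t) :
    |botSumOn 𝕊 ε₀ α X n t| ≤ 2 * (1 + ε₀) ^ ((5 : ℝ) * n / 2) * M * coeffAbsOn (botShifts 𝕊) α *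
      (∑ i, E i n t + ∑ i, E i (n + 1) t) :=
  abs_fullSumOn_le_energy h𝕊.botShifts ε₀ hε α X E n t hX hE hXE

/-- **Size of the bond flux from one amplitude bound** on a nearest-neighbour shift set:
`|X_{i,n}|, |X_{i,n+1}| ≤ M ⇒ |B_𝕊(n)| ≤ (1+ε₀)^{5n/2} M³ ∑_{botShifts} |α|`.
[cite: Tao2016AveragedNS, §4 proof of Lemma 4.1 (v); cell vocabulary, shift-set parametrised] -/
theorem abs_botSumOn_le_of_abs_le {𝕊 : Finset (ℤ × ℤ × ℤ)} (h𝕊 : IsNearestNeighbourSet 𝕊)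
    (ε₀ : ℝ) (hε : 0 < 1 + ε₀) (α : Fin m → Fin m → Fin m → ℤ × ℤ × ℤ → ℝ)
    (X : Fin m → ℤ → ℝ → ℝ) (n : ℤ) (t : ℝ) {M : ℝ} (hM : 0 ≤ M)
    (hX : ∀ i, |X i n t| ≤ M ∧ |X i (n + 1) t| ≤ M) :
    |botSumOn 𝕊 ε₀ α X n t| ≤ (1 + ε₀) ^ ((5 : ℝ) * n / 2) * M ^ 3 * coeffAbsOn (botShifts 𝕊) α :=
  abs_fullSumOn_le_of_abs_le h𝕊.botShifts ε₀ hε α X n t hM hX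

/-- **Size of the same-shell sum from one amplitude bound** on a nearest-neighbour shift set:
`|X_{i,n}|, |X_{i,n+1}| ≤ M ⇒ |A_𝕊(n)| ≤ (1+ε₀)^{5n/2} M³ ∑_{topShifts} |α|`.
[cite: Tao2016AveragedNS, §4 proof of Lemma 4.1 (v); cell vocabulary, shift-set parametrised] -/
theorem abs_topSumOn_le_of_abs_le {𝕊 : Finset (ℤ × ℤ × ℤ)} (h𝕊 : IsNearestNeighbourSet 𝕊)
    (ε₀ : ℝ) (hε : 0 < 1 + ε₀) (α : Fin m → Fin m → Fin m → ℤ × ℤ × ℤ → ℝ)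
    (X : Fin m → ℤ → ℝ → ℝ) (n : ℤ) (t : ℝ) {M : ℝ} (hM : 0 ≤ M)
    (hX : ∀ i, |X i n t| ≤ M ∧ |X i (n + 1) t| ≤ M) :
    |topSumOn 𝕊 ε₀ α X n t| ≤ (1 + ε₀) ^ ((5 : ℝ) * n / 2) * M ^ 3 * coeffAbsOn (topShifts 𝕊) α :=
  abs_fullSumOn_le_of_abs_le h𝕊.topShifts ε₀ hε α X n t hM hX

/-! ### Continuity -/

/-- The parametrised nonlinearity of a family of continuous amplitudes is continuous (finite sum
of products). [cite: Tao2016AveragedNS, §4 (4.8); cell vocabulary, shift-set parametrised] -/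
theorem continuousOn_quadTermOn (𝕊 : Finset (ℤ × ℤ × ℤ)) (ε₀ : ℝ)
    (α : Fin m → Fin m → Fin m → ℤ × ℤ × ℤ → ℝ) {S : Fin m → ℤ → ℝ → ℝ} {I : Set ℝ}
    (hS : ∀ i n, ContinuousOn (S i n) I) (i : Fin m) (n : ℤ) :
    ContinuousOn (fun t => quadTermOn 𝕊 ε₀ α S i n t) I := by
  unfold quadTermOn
  refine continuousOn_finsetSum _ fun i₁ _ => continuousOn_finsetSum _ fun i₂ _ =>
    continuousOn_finsetSum _ fun μ _ => ?_
  exact continuousOn_const.mul ((hS _ _).mul (hS _ _))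

/-- A cubic sum of a family of continuous amplitudes is continuous. [cite: Tao2016AveragedNS, §4 (4.3); cell vocabulary, shift-set parametrised] -/
theorem continuousOn_fullSumOn (𝕋 : Finset (ℤ × ℤ × ℤ)) (ε₀ : ℝ)
    (α : Fin m → Fin m → Fin m → ℤ × ℤ × ℤ → ℝ) {S : Fin m → ℤ → ℝ → ℝ} {I : Set ℝ}
    (hS : ∀ i n, ContinuousOn (S i n) I) (n : ℤ) :
    ContinuousOn (fun t => fullSumOn 𝕋 ε₀ α S n t) I := by
  unfold fullSumOn
  refine continuousOn_finsetSum _ fun i₁ _ => continuousOn_finsetSum _ fun i₂ _ =>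
    continuousOn_finsetSum _ fun i₃ _ => continuousOn_finsetSum _ fun μ _ => ?_
  exact continuousOn_const.mul (((hS _ _).mul (hS _ _)).mul (hS _ _))

/-- The bond flux of a family of continuous amplitudes is continuous. [cite: Tao2016AveragedNS, §4 (4.3); cell vocabulary, shift-set parametrised] -/
theorem continuousOn_botSumOn (𝕊 : Finset (ℤ × ℤ × ℤ)) (ε₀ : ℝ)
    (α : Fin m → Fin m → Fin m → ℤ × ℤ × ℤ → ℝ) {S : Fin m → ℤ → ℝ → ℝ} {I : Set ℝ}
    (hS : ∀ i n, ContinuousOn (S i n) I) (n : ℤ) :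
    ContinuousOn (fun t => botSumOn 𝕊 ε₀ α S n t) I :=
  continuousOn_fullSumOn (botShifts 𝕊) ε₀ α hS n

/-- The same-shell cubic sum of a family of continuous amplitudes is continuous. [cite: Tao2016AveragedNS, §4 (4.3); cell vocabulary, shift-set parametrised] -/
theorem continuousOn_topSumOn (𝕊 : Finset (ℤ × ℤ × ℤ)) (ε₀ : ℝ)
    (α : Fin m → Fin m → Fin m → ℤ × ℤ × ℤ → ℝ) {S : Fin m → ℤ → ℝ → ℝ} {I : Set ℝ}
    (hS : ∀ i n, ContinuousOn (S i n) I) (n : ℤ) :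
    ContinuousOn (fun t => topSumOn 𝕊 ε₀ α S n t) I :=
  continuousOn_fullSumOn (topShifts 𝕊) ε₀ α hS n

/-! ### The block energy inequality along a pseudo-flow on `𝕊` -/

section PseudoFlow

variable {𝕊 : Finset (ℤ × ℤ × ℤ)} {τ ε₀ : ℝ} {α : Fin m → Fin m → Fin m → ℤ × ℤ × ℤ → ℝ}
  {κ₁ κ₂ : ℝ} {S₀ F₀ B₀ : Fin m → ℤ → ℝ} {S F : Fin m → ℤ → ℝ → ℝ}

/-- **Per-shell energy cap along a pseudo-flow on `𝕊`**: (4.9) integrated from `F(0) = F₀`,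
`F_{i,k}(s) ≤ F₀_{i,k} + ∫₀^s quadTermOn 𝕊 _{i,k} · S_{i,k}` for `s ∈ [0, τ]`, `τ > 0`.
[cite: Tao2016AveragedNS, §4 Lemma 4.1 (4.9); cell vocabulary, shift-set parametrised] -/
theorem PseudoFlowOnShift.energy_cap (h : PseudoFlowOnShift 𝕊 τ ε₀ α κ₁ κ₂ S₀ F₀ B₀ S F)
    (hτ : 0 < τ) (i : Fin m) (k : ℤ) {s : ℝ} (hs : s ∈ Icc 0 τ) :
    F i k s ≤ F₀ i k + ∫ u in (0 : ℝ)..s, quadTermOn 𝕊 ε₀ α S i k u * S i k u := by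
  have hS : ∀ i n, ContinuousOn (S i n) (Icc 0 τ) := fun i n => (h.contDiffOn_S i n).continuousOn
  have hsubI : Icc 0 s ⊆ Icc 0 τ := Icc_subset_Icc_right hs.2
  have hsub : uIcc 0 s ⊆ Icc 0 τ := by rwa [uIcc_of_le hs.1]
  have hint : IntervalIntegrable (fun u => quadTermOn 𝕊 ε₀ α S i k u * S i k u) volume 0 s :=
    (((continuousOn_quadTermOn 𝕊 ε₀ α hS i k).mul (hS i k)).mono hsub).intervalIntegrable
  have hf := h.contDiffOn_F i k
  have hcont : ContinuousOn (F i k) (Icc 0 s) := hf.continuousOn.mono hsubI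
  have hf'cont : ContinuousOn (derivWithin (F i k) (Icc 0 τ)) (Icc 0 τ) :=
    hf.continuousOn_derivWithin (uniqueDiffOn_Icc hτ) le_rfl
  have hderiv : ∀ x ∈ Ioo 0 s, HasDerivAt (F i k) (derivWithin (F i k) (Icc 0 τ) x) x := by
    intro x hx
    have hxτ : x < τ := hx.2.trans_le hs.2
    have hxI : Icc 0 τ ∈ nhds x := Icc_mem_nhds hx.1 hxτ
    have hd : DifferentiableWithinAt ℝ (F i k) (Icc 0 τ) x :=
      (hf.differentiableOn one_ne_zero) x ⟨hx.1.le, hxτ.le⟩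
    rw [derivWithin_of_mem_nhds hxI]
    exact (hd.differentiableAt hxI).hasDerivAt
  have hint' : IntervalIntegrable (derivWithin (F i k) (Icc 0 τ)) volume 0 s :=
    (hf'cont.mono hsub).intervalIntegrable
  have hftc := intervalIntegral.integral_eq_sub_of_hasDerivAt_of_le hs.1 hcont hderiv hint'
  have hmono := intervalIntegral.integral_mono_on hs.1 hint' hint
    fun u hu => h.energy i k u (hsubI hu)
  rw [hftc, h.init_F i k] at hmono
  linarith

/-- **BLOCK ENERGY INEQUALITY on `𝕊`.** Along every pseudo-flow on `[0, τ]` on a slot-closed shift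
set with output slots in `{0,1}` and a cancelling table, for every finite block of shells
`K, K+1, …, K+L-1` and every `s ∈ [0, τ]`,
`∑_{k<L} ∑ᵢ F_{i,K+k}(s) ≤ ∑_{k<L} ∑ᵢ F₀_{i,K+k} + ∫₀^s (B_𝕊(K-1)(u) - B_𝕊(K+L-1)(u)) du`:
the energy of the block grows at most by the flux in through the bond below it minus the flux out
through the bond above it ((4.9) has no defect term; (4.3) telescopes the interior bonds). On `S♭`
each bond flux is the one-way flux corrected by a backscatter term quadratic in the shell above the
bond (`botSumOn_shiftSetFlat_eq_botSum_sub`). [cite: Tao2016AveragedNS, §4 Lemma 4.1 (4.9) with (4.3); cell vocabulary, shift-set parametrised] -/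
theorem PseudoFlowOnShift.block_energy_le (h : PseudoFlowOnShift 𝕊 τ ε₀ α κ₁ κ₂ S₀ F₀ B₀ S F)
    (hτ : 0 < τ) (h𝕊 : IsSlotClosed 𝕊) (h𝕊' : ∀ μ ∈ 𝕊, μ.2.2 = 0 ∨ μ.2.2 = 1)
    (hα : IsCancellingCoeffOn 𝕊 α) (K : ℤ) (L : ℕ) {s : ℝ} (hs : s ∈ Icc 0 τ) :
    ∑ k ∈ Finset.range L, ∑ i, F i (K + k) s ≤
      ∑ k ∈ Finset.range L, ∑ i, F₀ i (K + k) +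
        ∫ u in (0 : ℝ)..s, (botSumOn 𝕊 ε₀ α S (K - 1) u - botSumOn 𝕊 ε₀ α S (K + L - 1) u) := by
  have hS : ∀ i n, ContinuousOn (S i n) (Icc 0 τ) := fun i n => (h.contDiffOn_S i n).continuousOn
  have hsub : uIcc 0 s ⊆ Icc 0 τ := by
    rw [uIcc_of_le hs.1]
    exact Icc_subset_Icc_right hs.2
  have hq : ∀ (i : Fin m) (k : ℤ), ContinuousOn (fun t => quadTermOn 𝕊 ε₀ α S i k t) (Icc 0 τ) :=
    fun i k => continuousOn_quadTermOn 𝕊 ε₀ α hS i k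
  have hint : ∀ (i : Fin m) (k : ℤ),
      IntervalIntegrable (fun u => quadTermOn 𝕊 ε₀ α S i k u * S i k u) volume 0 s := fun i k =>
    (((hq i k).mul (hS i k)).mono hsub).intervalIntegrable
  have hint2 : ∀ k : ℤ,
      IntervalIntegrable (fun u => ∑ i, quadTermOn 𝕊 ε₀ α S i k u * S i k u) volume 0 s := fun k =>
    ((continuousOn_finsetSum _ fun i _ => (hq i k).mul (hS i k)).mono hsub).intervalIntegrable
  calc ∑ k ∈ Finset.range L, ∑ i, F i (K + k) s
      ≤ ∑ k ∈ Finset.range L, ∑ i,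
          (F₀ i (K + k) + ∫ u in (0 : ℝ)..s, quadTermOn 𝕊 ε₀ α S i (K + k) u * S i (K + k) u) :=
        Finset.sum_le_sum fun k _ => Finset.sum_le_sum fun i _ => h.energy_cap hτ i (K + k) hs
    _ = ∑ k ∈ Finset.range L, ∑ i, F₀ i (K + k) +
          ∑ k ∈ Finset.range L, ∑ i,
            ∫ u in (0 : ℝ)..s, quadTermOn 𝕊 ε₀ α S i (K + k) u * S i (K + k) u := by
        simp only [Finset.sum_add_distrib]
    _ = ∑ k ∈ Finset.range L, ∑ i, F₀ i (K + k) +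
          ∫ u in (0 : ℝ)..s, ∑ k ∈ Finset.range L, ∑ i,
            quadTermOn 𝕊 ε₀ α S i (K + k) u * S i (K + k) u := by
        congr 1
        rw [intervalIntegral.integral_finsetSum (s := Finset.range L) fun (k : ℕ) _ => hint2 (K + k)]
        exact Finset.sum_congr rfl fun k _ =>
          (intervalIntegral.integral_finsetSum fun i _ => hint i (K + k)).symm
    _ = ∑ k ∈ Finset.range L, ∑ i, F₀ i (K + k) +
          ∫ u in (0 : ℝ)..s, (botSumOn 𝕊 ε₀ α S (K - 1) u - botSumOn 𝕊 ε₀ α S (K + L - 1) u) := by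
        congr 1
        refine intervalIntegral.integral_congr fun u _ => ?_
        exact sum_range_sum_quadTermOn_mul_eq_botSumOn h𝕊 h𝕊' ε₀ hα S K L u

end PseudoFlow

end TaoCascade

end Literature.Analysis.FluidPDE
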